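import Literature.Probability.LatticeModels.LocalPerturbationClusterExpansion

/-!
Sketch (ideator ym-r3-idea-1 g19, crux idea «neumann-frd-step», item E′ of card v1.1): the WEIGHTED edition of the tree's
local-perturbation engine `Literature.Probability.LatticeModels.LocalPerturbation{PolymerGas,ClusterExpansion}`.
The tree's `isKPVolume_connActivity` asks a UNIFORM factor bound `ε` and a UNIFORM degree `Δ` (`e·ε·(Δ+1)² ≤ ½`); from the
second finite-range sub-field on, the factors are indexed by POLYMERS of the previous step (weights `e^{-τ|X|}`, unbounded
degree), so the engine is needed with size-dependent weights and the PINNED criterion (the format of ✓KPL-E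
`…S2BetaKPLCriterion.kp_of_pinned_criterion`).  Two statements, generic (no gauge theory), elaboration only; nothing proved.
-/

namespace Summit.QuantumFields.YangMills.Cruxes.FluctuationComparisonRegPrIntL.EPrime

open Literature.Probability.LatticeModels MeasureTheory Finset
open scoped BigOperators

/-- **E′-COMB — pinned connected-subfamily sums.**  For a reflexive symmetric incompatibility `inc` on `P`, weights `w ≥ 0`
and a size function `a` satisfying the (real, finite-volume) Kotecký–Preiss criterion on `Λ`, the sum over the
`inc`-connected subfamilies of `Λ` pinned at `γ₀` of the weight products is at most `w γ₀ · e^{a γ₀}`.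
(Proof route: induction on `Λ` — remove `γ₀`, split the rest into connected components each incompatible with `γ₀`,
bound by `exp` of the pinned sums in `Λ \ {γ₀}`, use the criterion.  [KoteckyPreiss1986, §2]; [FriedliVelenik2017, §5.4].) -/
def PinnedConnectedFamilyBound : Prop :=
  ∀ (P : Type) [DecidableEq P] (inc : P → P → Prop) [DecidableRel inc] (w a : P → ℝ) (Λ : Finset P),
    (∀ γ, inc γ γ) → (∀ γ γ', inc γ γ' → inc γ' γ) → (∀ γ, 0 ≤ w γ) →
    (∀ γ ∈ Λ, ∑ γ' ∈ Λ with inc γ' γ, w γ' * Real.exp (a γ') ≤ a γ) →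
    ∀ γ₀ ∈ Λ, ∑ 𝒦 ∈ (rconnSubsets inc Λ).filter (fun 𝒦 => γ₀ ∈ 𝒦), ∏ γ ∈ 𝒦, w γ
      ≤ w γ₀ * Real.exp (a γ₀)

/-- **E′ — the weighted local-perturbation engine.**  A local perturbation of a finite-range reference process (the tree's
`IsLocalPerturbation μ R 𝓕 g ε`: cell σ-algebras, independence of non-touching cell sets, `𝓕 p`-measurable factors) whose
factors obey CELL-DEPENDENT bounds `‖g v ω‖ ≤ w v` and the DOUBLED-EXPONENT pinned criterion
`∀ v ∈ C, ∑_{u ∈ C, u = v ∨ R u v} w u · e^{2 a u} ≤ a v` has connected activities forming a KP volume on the polymers of `C`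
with size function `K ↦ ∑_{v ∈ K} a v` — whence (tree, generic KP) `exp (log Z) = Z`, `log Z = Σ φᵀ`, and a `PolymerRepOn`
via ✓`…S2BetaKPLogRep.polymerRep_of_kpGas`.  (Proof route: `‖connActivity K'‖ ≤ ∏_{v ∈ K'} w v`; a polymer incompatible
with `K` contains a cell `u` equal or adjacent to a cell `v ∈ K`; `PinnedConnectedFamilyBound` with weights `w·e^{a}`.)
USE (crux idea `neumann-frd-step`, iteration across finite-range sub-fields): index type `V` := the previous step's polymers
`X` with `𝓕 X := ⨆_{p ∈ X̄} 𝓕₀ p`, `R` := touching of `r`-neighbourhoods, `w X := e^{-τ|X|}`, `a X := (τ/4)|X|`. -/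
def WeightedLocalPerturbationKP : Prop :=
  ∀ (V Ω : Type) [DecidableEq V] [MeasurableSpace Ω] (μ : Measure Ω) [IsProbabilityMeasure μ]
    (R : V → V → Prop) [DecidableRel R] (𝓕 : V → MeasurableSpace Ω) (g : V → Ω → ℂ) (ε : ℝ) (w a : V → ℝ)
    (C : Finset V),
    (∀ x y, R x y → R y x) → IsLocalPerturbation μ R 𝓕 g ε → (∀ v ω, ‖g v ω‖ ≤ w v) → (∀ v, 0 ≤ a v) →
    (∀ v ∈ C, ∑ u ∈ C with (u = v ∨ R u v), w u * Real.exp (2 * a u) ≤ a v) →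
    IsKPVolume (GeomInc R) (connActivity R μ g) (fun K => ∑ v ∈ K, a v) (rconnSubsets R C)

end Summit.QuantumFields.YangMills.Cruxes.FluctuationComparisonRegPrIntL.EPrime
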